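import Mathlib
import HarnessLib
import Summits.HubbardSuperconductivity.HubbardSuperconductivity.Theorems.KLProgrammeC4aSliceIncrementAssembly
import Summits.HubbardSuperconductivity.HubbardSuperconductivity.Theorems.KLProgrammeC4aCoMovingJetsL1Theta

/-!
# Route `KLProgramme` — crux C4a, the (A) capstone (plain and value forms) in SUP-OUTSIDE currency: the (L3) input as `CoMovingJetsL1Theta`
# (co-moving dominators that may depend on the base angle θ)

Cell `gate-hubbard-kl`, seat hubbard-kl-k3c3-p3 (g28; row «implicit-function / monotonicity route for μ(n)»).  Located brick for the (C)-closer lane hubbard-kl-c4a-1 /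
p1b (stub (C) `stub_twoLeg_curvature` of `KLRegimeEngineV17F2`, stmt-HubbardSuperconductivity-20437), memo HOME/hubbard-kl-k3c3-p3/U1-CAUSTIC-SUP.md §2 (F1);
companion of `…C4aTadpoleJetAssemblyRefTheta` (the reference-subtracted form).  WHY: the θ-UNIFORM (L3) dominators of `CoMovingJetsL1` cannot have `n`-free angular
integrals at order `≥ 1` for the bubble piece (umklapp caustics crossed along θ-orbits: `sup_θ|∂_θ𝐁| ≍ Λ_n^{−1/2}` on 63–88 % of the relative angles); the crux needs the
bound pointwise in `θ` with the loop integral inside, which `CoMovingJetsL1Theta` expresses.  This file re-threads, verbatim except for the (L3) slot: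
* §1 **`abs_iteratedDeriv_re_tadpoleCont_comp_le_theta`** (twin of `…C4aTadpoleJetAssembly.abs_iteratedDeriv_re_tadpoleCont_comp_le`);
* §2 **`twoLegCurveJetBound_succ_of_inputs_theta`**, **`twoLegCurveJetBound_succ_of_inputs_value_theta`** (twins of `…C4aSliceIncrementAssembly`'s capstones):
  `TwoLegCurveJetBound L M c c′ β U μ K (n+1)` from `hVJ : ∀ p₀, CoMovingJetsL1Theta 4 (aV p₀) r μ K (tadpoleVertex β 𝒱_n p₀)` and
  `hMv : ∀ p₀ θ, ∀ i ≤ 4, ∀ ρ ∈ (−r,r), ∫dϑ aV p₀ θ i (ρ,ϑ) ≤ Mv p₀ i` plus the other named inputs, unchanged.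
Composition only; nothing is asserted about the Hubbard model's sizes; nothing asserts (C), K3 or superconductivity.
References: BGM 2006 §2.4 (2.36)–(2.42) [cite: BenfattoGiulianiMastropietro2006]; FST II CPAM 51 (1998) §3 [cite: FeldmanSalmhoferTrubowitz1998].
-/

noncomputable section

namespace Summit.HubbardSuperconductivity.HubbardSuperconductivity.Theorems.C4a

set_option linter.dupNamespace false -- summit = problem name (single-conjunct summit), D-0017

open Real Set MeasureTheory Finset
open scoped ContDiff
open Literature.MathematicalPhysics.QuantumLattice Literature.MathematicalPhysics.QuantumLattice.BandSectorCounting Literature.Probability.LatticeModels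
open GrassmannAlgebra
open Summit.HubbardSuperconductivity.HubbardSuperconductivity.Theorems.KLRegimeSplit
open Summit.HubbardSuperconductivity.HubbardSuperconductivity.Theorems.KLProgrammeLegKernels
open Summit.HubbardSuperconductivity.HubbardSuperconductivity.Theorems.KLRegimeWick
open Summit.HubbardSuperconductivity.HubbardSuperconductivity.Theorems.DispersionFlow
open Summit.HubbardSuperconductivity.HubbardSuperconductivity.Theorems.PerturbedFermiCurve

/-! ## §1–§2 The one-line jets assembly and the (A) capstones, θ-dependent dominators -/

section Assembly

variable {L M : ℕ} [NeZero L] [NeZero M]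
variable {a b : ℝ} (B : BandBounds a b) {K : TrigPolyC4v} {A : ℝ}
  (hA : ∀ p : Momentum, ∀ j ≤ 2, ‖iteratedFDeriv ℝ j (frameShift K) p‖ ≤ A) (hADt : 2 * A < B.Dtmin)
  {μ r : ℝ} (hr : 0 < r) (hlo : a < μ - r - A) (hhi : μ + r + A < b)
include B hA hADt hr hlo hhi

/-- **THE ONE-LINE JETS ASSEMBLY, SUP-OUTSIDE dominators.**  Twin of `…C4aTadpoleJetAssembly.abs_iteratedDeriv_re_tadpoleCont_comp_le` with the (L3) input
`CoMovingJetsL1Theta N (aV p₀) r μ K (tadpoleVertex β W p₀)` (dominators per base angle; `∫dϑ aV p₀ θ i ≤ Mv p₀ i` for every `θ`).  `β ≠ 0`, `0 < Λ ≤ Λ′ < r`, band hypotheses at the frame `K` with tube radius `r`; for every kept frequency `p₀` the vertex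
`tadpoleVertex β W p₀` has co-moving `L¹(dϑ)` dominators `CoMovingJetsL1Theta N (aV p₀) r μ K ·` with uniform angular integrals `≤ Mv p₀ i` (the (L3) input);
Jacobian jets `≤ G_i`; alias tables `Da p₀` (`M ≥ 4`); the Fermi-point map `γ = toLp ∘ k_F^K` is `C⁴` with `‖γ⁽ⁱ⁾(θ)‖ ≤ D_i`.  Then for `j ≤ N ≤ 4`:
`|∂_θʲ Re tadpoleCont(k_F^K θ)| ≤ (2π)⁻²·Σ_{p₀}(Σ_{i≤j} C(j,i)·G_i·Mv_{p₀,j−i})·∫_{(−r,r)}‖ŝ_{p₀}‖ + bell4 (k ↦ Lᵏ·mass·Σ_{p₀} tail_{p₀}) D j`.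
[cite: BenfattoGiulianiMastropietro2006, §2.4 (2.36)] -/
theorem abs_iteratedDeriv_re_tadpoleCont_comp_le_theta {β : ℝ} (hβ : β ≠ 0) {Λ Λ' : ℝ} (hΛ : 0 < Λ) (hΛΛ' : Λ ≤ Λ') (hΛr : Λ' < r)
    (W : HubbardGrassmann L M) {N : ℕ} (hN : N ≤ 4)
    {G : ℕ → ℝ} (hJjet : ∀ ρ, |ρ| < r → ∀ i ≤ N, ∀ s, ‖iteratedDeriv i (fun s => levelChartJac μ K (ρ, s)) s‖ ≤ G i)
    {aV : MatsubaraIdx M → ℝ → ℕ → ℝ × ℝ → ℝ} (hVJ : ∀ p₀ : MatsubaraIdx M, CoMovingJetsL1Theta N (aV p₀) r μ K (tadpoleVertex β W p₀))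
    {Mv : MatsubaraIdx M → ℕ → ℝ} (hMv : ∀ (p₀ : MatsubaraIdx M) (θ : ℝ), ∀ i ≤ N, ∀ ρ ∈ Ioo (-r) r, ∫ ϑ in Ioc 0 (2 * π), aV p₀ θ i (ρ, ϑ) ≤ Mv p₀ i)
    {Mdeg : ℕ} (hM : 4 ≤ Mdeg) {Da : MatsubaraIdx M → ℝ}
    (hDa : ∀ (p₀ : MatsubaraIdx M) (y : Momentum), ‖iteratedFDeriv ℝ Mdeg (fun y : Momentum =>
      sliceSymbolFnXi (β * (L : ℝ) ^ 2) 0 Λ Λ' (matsubaraFreq β M p₀) (frameLevel μ K ((2 * π) • y))) y‖ ≤ Da p₀)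
    (hγ : ContDiff ℝ 4 fun θ : ℝ => (WithLp.toLp 2 (klFermiPoint μ K θ) : Momentum)) {θ : ℝ} {D : ℕ → ℝ}
    (hD : ∀ i, 1 ≤ i → i ≤ 4 → ‖iteratedDeriv i (fun θ : ℝ => (WithLp.toLp 2 (klFermiPoint μ K θ) : Momentum)) θ‖ ≤ D i)
    {Mk : ℕ → ℝ}
    (hMk : ∀ k, Mk k = (L : ℝ) ^ k * (6 * |β| * (L : ℝ) ^ 4 * ∑ σ : Fin 2, ∑ τ : Fin 2, 2 * (((Fintype.card (SpaceTimeIdx L M) : ℝ) ^ 4)⁻¹ *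
        ∑ x : Fin 4 → SpaceTimeIdx L M, ‖positionKernel L M β W 4 (fun i => ((x i, ![σ, σ, τ, τ] i), (![0, 1, 1, 0] : Fin 4 → Fin 2) i))‖)) *
          ∑ p₀ : MatsubaraIdx M, Da p₀ / (2 * Real.pi) ^ Mdeg * (2 / (L : ℝ)) ^ (Mdeg - 4) * (4 * ∑' k : Fin 2 → ℤ, ∏ j, (1 + (k j : ℝ) ^ 2)⁻¹))
    {j : ℕ} (hj : j ≤ N) :
    |iteratedDeriv j (fun θ : ℝ => (tadpoleCont β μ K Λ Λ' W (klFermiPoint μ K θ)).re) θ| ≤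
      ((2 * π) ^ 2)⁻¹ * (∑ p₀ : MatsubaraIdx M, (∑ i ∈ Finset.range (j + 1), (j.choose i : ℝ) * G i * Mv p₀ (j - i)) *
          ∫ ρ in Ioo (-r) r, ‖sliceSymbolFnXi (β * (L : ℝ) ^ 2) 0 Λ Λ' (matsubaraFreq β M p₀) ρ‖) +
        bell4 Mk D j := by
  have hj4 : j ≤ 4 := hj.trans hN
  -- the two pieces as named functions
  obtain ⟨TT, hTT⟩ : ∃ TT : MatsubaraIdx M → ℝ → ℂ, TT = fun p₀ θ =>
      ∫ q in {q : ℝ × ℝ | |q.1| < π ∧ |q.2| < π ∧ |frameLevel μ K (WithLp.toLp 2 ![q.1, q.2])| < r},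
        sliceSymbolFnXi (β * (L : ℝ) ^ 2) 0 Λ Λ' (matsubaraFreq β M p₀) (frameLevel μ K (WithLp.toLp 2 ![q.1, q.2])) *
          tadpoleVertex β W p₀ (levelPoint μ K 0 θ) (WithLp.toLp 2 ![q.1, q.2]) := ⟨_, rfl⟩
  obtain ⟨Al, hAl⟩ : ∃ Al : Momentum → ℂ, Al = fun P : Momentum =>
      ∑ p₀ : MatsubaraIdx M, ∑ y : TorusSite 2 L, tadpoleCoeff β W p₀ (WithLp.ofLp P) y * aliasErr β μ K Λ Λ' r p₀ y := ⟨_, rfl⟩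
  have hTTcd : ∀ p₀, ContDiff ℝ ∞ (TT p₀) := fun p₀ => by
    rw [hTT]
    exact contDiff_tubeTadpole B hA hADt hr hlo hhi (sliceSymbolFnXi_matsubara_contDiff hβ L M p₀ Λ Λ')
      (sliceSymbolFnXi_matsubara_tsupport_subset L M p₀ hΛ hΛΛ' hΛr) (contDiff_tadpoleVertex β W p₀)
  have hAlcd : ContDiff ℝ 4 Al := by rw [hAl]; exact contDiff_aliasSum β W _
  -- the decomposition along the curve
  have hdec : (fun θ : ℝ => (tadpoleCont β μ K Λ Λ' W (klFermiPoint μ K θ)).re) =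
      fun θ : ℝ => (∑ p₀ : MatsubaraIdx M, ((((2 * π) ^ 2)⁻¹ : ℝ) : ℂ) * TT p₀ θ).re +
        ((fun P : Momentum => (Al P).re) ∘ fun θ : ℝ => (WithLp.toLp 2 (klFermiPoint μ K θ) : Momentum)) θ := by
    funext θ'
    rw [tadpoleCont_eq_tubeTadpoles_add_alias hβ μ K Λ Λ' r W, Complex.add_re, hTT, hAl]
    simp only [Function.comp_apply, levelPoint_zero, Complex.real_smul]
  -- smoothness of the two pieces
  have hTT4 : ∀ p₀, ContDiff ℝ 4 (TT p₀) := fun p₀ => contDiff_infty.1 (hTTcd p₀) 4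
  have hTTj : ∀ p₀, ContDiff ℝ j (TT p₀) := fun p₀ => (hTT4 p₀).of_le (by exact_mod_cast hj4)
  have hsum : ContDiff ℝ 4 fun θ : ℝ => ∑ p₀ : MatsubaraIdx M, ((((2 * π) ^ 2)⁻¹ : ℝ) : ℂ) * TT p₀ θ :=
    ContDiff.sum fun p₀ _ => contDiff_const.mul (hTT4 p₀)
  have h1 : ContDiff ℝ 4 fun θ : ℝ => (∑ p₀ : MatsubaraIdx M, ((((2 * π) ^ 2)⁻¹ : ℝ) : ℂ) * TT p₀ θ).re :=
    Complex.reCLM.contDiff.comp hsum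
  have h2 : ContDiff ℝ 4 ((fun P : Momentum => (Al P).re) ∘ fun θ : ℝ => (WithLp.toLp 2 (klFermiPoint μ K θ) : Momentum)) :=
    (Complex.reCLM.contDiff.comp hAlcd).comp hγ
  rw [hdec, iteratedDeriv_fun_add (h1.contDiffAt.of_le (by exact_mod_cast hj4)) (h2.contDiffAt.of_le (by exact_mod_cast hj4))]
  refine (abs_add_le _ _).trans (add_le_add ?_ ?_)
  · -- the tube tadpoles
    refine (abs_iteratedDeriv_re_le (hsum.of_le (by exact_mod_cast hj4)) θ).trans ?_
    rw [iteratedDeriv_fun_sum fun p₀ _ => ((contDiff_const.mul (hTTj p₀)).contDiffAt :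
      ContDiffAt ℝ j (fun θ => ((((2 * π) ^ 2)⁻¹ : ℝ) : ℂ) * TT p₀ θ) θ)]
    refine (norm_sum_le _ _).trans ?_
    rw [Finset.mul_sum]
    refine Finset.sum_le_sum fun p₀ _ => ?_
    rw [iteratedDeriv_const_mul _ (hTTj p₀).contDiffAt, norm_mul,
      Complex.norm_real, Real.norm_of_nonneg (by positivity)]
    refine mul_le_mul_of_nonneg_left ?_ (by positivity)
    rw [hTT]
    exact norm_iteratedDeriv_tubeTadpole_le_of_L1Theta_unif B hA hADt hr hlo hhi (sliceSymbolFnXi_matsubara_contDiff hβ L M p₀ Λ Λ')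
      (sliceSymbolFnXi_matsubara_tsupport_subset L M p₀ hΛ hΛΛ' hΛr) hJjet (contDiff_tadpoleVertex β W p₀) (hVJ p₀) (hMv p₀) hj θ
  · -- the aliasing term
    rw [hAl]
    exact abs_iteratedDeriv_re_aliasSum_comp_le_bell4 W
      (fun p₀ y => norm_aliasErr_le hβ μ K hΛ hΛΛ' hΛr p₀ hM (hDa p₀) y) hγ hD hMk hj4


/-- **THE (A) CAPSTONE from named inputs, SUP-OUTSIDE dominators.**  Twin of `…C4aSliceIncrementAssembly.twoLegCurveJetBound_succ_of_inputs` with the (L3)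
input in `CoMovingJetsL1Theta` form. [cite: BenfattoGiulianiMastropietro2006, §2.4 (2.36)] -/
theorem twoLegCurveJetBound_succ_of_inputs_theta {β : ℝ} (hβ : β ≠ 0) (U : ℝ) (n : ℕ)
    (hΛ : 0 < klScale klE0 (n + 1)) (hΛΛ' : klScale klE0 (n + 1) ≤ klScale klE0 n) (hΛr : klScale klE0 n < r)
    (hZ : hubbardEffPartitionFnCT L M β U μ 0 K (klScale klE0 n) ≠ 0)
    -- (ii) Jacobian jets on the tube
    {G : ℕ → ℝ} (hJjet : ∀ ρ, |ρ| < r → ∀ i ≤ 4, ∀ s, ‖iteratedDeriv i (fun s => levelChartJac μ K (ρ, s)) s‖ ≤ G i)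
    -- (i) the (L3) input: co-moving L¹(dϑ) dominators of the continuum tadpole vertex, per kept frequency
    {aV : MatsubaraIdx M → ℝ → ℕ → ℝ × ℝ → ℝ}
    (hVJ : ∀ p₀ : MatsubaraIdx M, CoMovingJetsL1Theta 4 (aV p₀) r μ K (tadpoleVertex β (klEffectiveAction L M β U μ K klE0 n) p₀))
    {Mv : MatsubaraIdx M → ℕ → ℝ} (hMv : ∀ (p₀ : MatsubaraIdx M) (θ : ℝ), ∀ i ≤ 4, ∀ ρ ∈ Ioo (-r) r, ∫ ϑ in Ioc 0 (2 * π), aV p₀ θ i (ρ, ϑ) ≤ Mv p₀ i)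
    -- (iii) alias derivative tables
    {Mdeg : ℕ} (hM : 4 ≤ Mdeg) {Da : MatsubaraIdx M → ℝ}
    (hDa : ∀ (p₀ : MatsubaraIdx M) (y : Momentum), ‖iteratedFDeriv ℝ Mdeg (fun y : Momentum =>
      sliceSymbolFnXi (β * (L : ℝ) ^ 2) 0 (klScale klE0 (n + 1)) (klScale klE0 n) (matsubaraFreq β M p₀) (frameLevel μ K ((2 * π) • y))) y‖ ≤ Da p₀)
    -- (iv) the Fermi-point map and its sizes
    (hγ : ContDiff ℝ 4 fun θ : ℝ => (WithLp.toLp 2 (klFermiPoint μ K θ) : Momentum)) {D : ℕ → ℝ}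
    (hD : ∀ θ : ℝ, ∀ i, 1 ≤ i → i ≤ 4 → ‖iteratedDeriv i (fun θ : ℝ => (WithLp.toLp 2 (klFermiPoint μ K θ) : Momentum)) θ‖ ≤ D i)
    -- the alias Bell constants
    {Mk : ℕ → ℝ}
    (hMk : ∀ k, Mk k = (L : ℝ) ^ k * (6 * |β| * (L : ℝ) ^ 4 * ∑ σ : Fin 2, ∑ τ : Fin 2, 2 * (((Fintype.card (SpaceTimeIdx L M) : ℝ) ^ 4)⁻¹ *
        ∑ x : Fin 4 → SpaceTimeIdx L M, ‖positionKernel L M β (klEffectiveAction L M β U μ K klE0 n) 4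
          (fun i => ((x i, ![σ, σ, τ, τ] i), (![0, 1, 1, 0] : Fin 4 → Fin 2) i))‖)) *
          ∑ p₀ : MatsubaraIdx M, Da p₀ / (2 * Real.pi) ^ Mdeg * (2 / (L : ℝ)) ^ (Mdeg - 4) * (4 * ∑' k : Fin 2 → ℤ, ∏ j, (1 + (k j : ℝ) ^ 2)⁻¹))
    -- (v) the fit against the bars
    {c c' : ℕ → ℝ}
    (hfit : ∀ k ≤ 4,
      ((2 * π) ^ 2)⁻¹ * (∑ p₀ : MatsubaraIdx M, (∑ i ∈ Finset.range (k + 1), (k.choose i : ℝ) * G i * Mv p₀ (k - i)) *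
          ∫ ρ in Ioo (-r) r, ‖sliceSymbolFnXi (β * (L : ℝ) ^ 2) 0 (klScale klE0 (n + 1)) (klScale klE0 n) (matsubaraFreq β M p₀) ρ‖) +
        bell4 Mk D k +
        bell4 (twoPointMoment β
          (gaussConv ℂ (hubbardCovSliceCT L M β μ 0 K (klScale klE0 (n + 1)) (klScale klE0 n)) (klEffectiveAction L M β U μ K klE0 n) -
            klEffectiveAction L M β U μ K klE0 n -
            grassmannLaplacian ℂ (hubbardCovSliceCT L M β μ 0 K (klScale klE0 (n + 1)) (klScale klE0 n))
              (klEffectiveAction L M β U μ K klE0 n))) D k +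
        bell4 (twoPointMoment β
          (effAction ℂ (hubbardCovSliceCT L M β μ 0 K (klScale klE0 (n + 1)) (klScale klE0 n)) (klEffectiveAction L M β U μ K klE0 n) -
            gaussConv ℂ (hubbardCovSliceCT L M β μ 0 K (klScale klE0 (n + 1)) (klScale klE0 n)) (klEffectiveAction L M β U μ K klE0 n))) D k ≤
      curveJetBar c c' U k (n + 1)) :
    TwoLegCurveJetBound L M c c' β U μ K (n + 1) := by
  have hlo' : a ≤ μ - A := by linarith
  have hhi' : μ + A ≤ b := by linarith
  -- the three Grassmann elements and the three readings
  obtain ⟨W, hW⟩ : ∃ W : HubbardGrassmann L M, W = klEffectiveAction L M β U μ K klE0 n := ⟨_, rfl⟩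
  obtain ⟨R₁, hR₁⟩ : ∃ R₁ : HubbardGrassmann L M, R₁ =
      gaussConv ℂ (hubbardCovSliceCT L M β μ 0 K (klScale klE0 (n + 1)) (klScale klE0 n)) (klEffectiveAction L M β U μ K klE0 n) -
        klEffectiveAction L M β U μ K klE0 n -
        grassmannLaplacian ℂ (hubbardCovSliceCT L M β μ 0 K (klScale klE0 (n + 1)) (klScale klE0 n)) (klEffectiveAction L M β U μ K klE0 n) :=
    ⟨_, rfl⟩
  obtain ⟨R₂, hR₂⟩ : ∃ R₂ : HubbardGrassmann L M, R₂ =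
      effAction ℂ (hubbardCovSliceCT L M β μ 0 K (klScale klE0 (n + 1)) (klScale klE0 n)) (klEffectiveAction L M β U μ K klE0 n) -
        gaussConv ℂ (hubbardCovSliceCT L M β μ 0 K (klScale klE0 (n + 1)) (klScale klE0 n)) (klEffectiveAction L M β U μ K klE0 n) := ⟨_, rfl⟩
  rw [← hW] at hVJ hMk
  rw [← hR₁, ← hR₂] at hfit
  -- the one function and its three smooth summands
  set T : (Fin 2 → ℝ) → ℂ := fun P =>
    tadpoleCont β μ K (klScale klE0 (n + 1)) (klScale klE0 n) W P + localReadingCont β R₁ P + localReadingCont β R₂ P with hTdef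
  have hT : T = fun P =>
      tadpoleCont β μ K (klScale klE0 (n + 1)) (klScale klE0 n) (klEffectiveAction L M β U μ K klE0 n) P +
        localReadingCont β
          (gaussConv ℂ (hubbardCovSliceCT L M β μ 0 K (klScale klE0 (n + 1)) (klScale klE0 n)) (klEffectiveAction L M β U μ K klE0 n) -
            klEffectiveAction L M β U μ K klE0 n -
            grassmannLaplacian ℂ (hubbardCovSliceCT L M β μ 0 K (klScale klE0 (n + 1)) (klScale klE0 n))
              (klEffectiveAction L M β U μ K klE0 n)) P +
        localReadingCont β
          (effAction ℂ (hubbardCovSliceCT L M β μ 0 K (klScale klE0 (n + 1)) (klScale klE0 n)) (klEffectiveAction L M β U μ K klE0 n) -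
            gaussConv ℂ (hubbardCovSliceCT L M β μ 0 K (klScale klE0 (n + 1)) (klScale klE0 n)) (klEffectiveAction L M β U μ K klE0 n)) P := by
    rw [hTdef, hW, hR₁, hR₂]
  have h1 : ContDiff ℝ 4 fun θ : ℝ => (tadpoleCont β μ K (klScale klE0 (n + 1)) (klScale klE0 n) W (klFermiPoint μ K θ)).re :=
    IsCharPoly.contDiff_re_comp_klFermiPoint B hA hADt hlo' hhi' (isCharPoly_tadpoleCont β μ K _ _ W)
  have h2 : ContDiff ℝ 4 fun θ : ℝ => (localReadingCont β R₁ (klFermiPoint μ K θ)).re :=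
    IsCharPoly.contDiff_re_comp_klFermiPoint B hA hADt hlo' hhi' (isCharPoly_localReadingCont β R₁)
  have h3 : ContDiff ℝ 4 fun θ : ℝ => (localReadingCont β R₂ (klFermiPoint μ K θ)).re :=
    IsCharPoly.contDiff_re_comp_klFermiPoint B hA hADt hlo' hhi' (isCharPoly_localReadingCont β R₂)
  have hsplit : (fun θ' : ℝ => (T (klFermiPoint μ K θ')).re) = fun θ' : ℝ =>
      (tadpoleCont β μ K (klScale klE0 (n + 1)) (klScale klE0 n) W (klFermiPoint μ K θ')).re +
        (localReadingCont β R₁ (klFermiPoint μ K θ')).re + (localReadingCont β R₂ (klFermiPoint μ K θ')).re := by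
    funext θ'
    rw [hTdef]
    simp only [Complex.add_re]
  refine twoLegCurveJetBound_succ_of_jets B hA hADt hlo' hhi' hβ U n hZ hT fun k hk θ => ?_
  have hk' : (k : WithTop ℕ∞) ≤ 4 := by exact_mod_cast hk
  rw [hsplit, iteratedDeriv_fun_add ((h1.add h2).contDiffAt.of_le hk') (h3.contDiffAt.of_le hk'),
    iteratedDeriv_fun_add (h1.contDiffAt.of_le hk') (h2.contDiffAt.of_le hk')]
  refine le_trans ?_ (hfit k hk)
  refine (abs_add_le _ _).trans (add_le_add ((abs_add_le _ _).trans (add_le_add ?_ ?_)) ?_)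
  · exact abs_iteratedDeriv_re_tadpoleCont_comp_le_theta B hA hADt hr hlo hhi hβ hΛ hΛΛ' hΛr W le_rfl hJjet hVJ hMv hM hDa hγ (hD θ) hMk hk
  · exact abs_iteratedDeriv_re_localReadingCont_klFermiPoint_le β μ K R₁ hγ (hD θ) hk
  · exact abs_iteratedDeriv_re_localReadingCont_klFermiPoint_le β μ K R₂ hγ (hD θ) hk

/-! ## §2 The same with the VALUE line (`k = 0`) supplied separately

The tube-jet line at `k = 0` is the slice MASS law `4^{−n}` (memo §17.1), one power short of the slot's `16^{−n}`; the honest `k = 0` input is the PAIRED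
value bound of `…C4aTadpoleValueAssembly` (or any other value bound `V₀`).  This form takes the one-line value bound as a separate hypothesis and uses the
tube-jet line only for `1 ≤ k ≤ 4`. -/

/-- **THE (A) CAPSTONE with the one-line VALUE bound, SUP-OUTSIDE dominators.**  Twin of `…C4aSliceIncrementAssembly.twoLegCurveJetBound_succ_of_inputs_value`
with the (L3) input in `CoMovingJetsL1Theta` form. [cite: BenfattoGiulianiMastropietro2006, §2.4 (2.36)] -/
theorem twoLegCurveJetBound_succ_of_inputs_value_theta {β : ℝ} (hβ : β ≠ 0) (U : ℝ) (n : ℕ)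
    (hΛ : 0 < klScale klE0 (n + 1)) (hΛΛ' : klScale klE0 (n + 1) ≤ klScale klE0 n) (hΛr : klScale klE0 n < r)
    (hZ : hubbardEffPartitionFnCT L M β U μ 0 K (klScale klE0 n) ≠ 0)
    {G : ℕ → ℝ} (hJjet : ∀ ρ, |ρ| < r → ∀ i ≤ 4, ∀ s, ‖iteratedDeriv i (fun s => levelChartJac μ K (ρ, s)) s‖ ≤ G i)
    {aV : MatsubaraIdx M → ℝ → ℕ → ℝ × ℝ → ℝ}
    (hVJ : ∀ p₀ : MatsubaraIdx M, CoMovingJetsL1Theta 4 (aV p₀) r μ K (tadpoleVertex β (klEffectiveAction L M β U μ K klE0 n) p₀))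
    {Mv : MatsubaraIdx M → ℕ → ℝ} (hMv : ∀ (p₀ : MatsubaraIdx M) (θ : ℝ), ∀ i ≤ 4, ∀ ρ ∈ Ioo (-r) r, ∫ ϑ in Ioc 0 (2 * π), aV p₀ θ i (ρ, ϑ) ≤ Mv p₀ i)
    {Mdeg : ℕ} (hM : 4 ≤ Mdeg) {Da : MatsubaraIdx M → ℝ}
    (hDa : ∀ (p₀ : MatsubaraIdx M) (y : Momentum), ‖iteratedFDeriv ℝ Mdeg (fun y : Momentum =>
      sliceSymbolFnXi (β * (L : ℝ) ^ 2) 0 (klScale klE0 (n + 1)) (klScale klE0 n) (matsubaraFreq β M p₀) (frameLevel μ K ((2 * π) • y))) y‖ ≤ Da p₀)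
    (hγ : ContDiff ℝ 4 fun θ : ℝ => (WithLp.toLp 2 (klFermiPoint μ K θ) : Momentum)) {D : ℕ → ℝ}
    (hD : ∀ θ : ℝ, ∀ i, 1 ≤ i → i ≤ 4 → ‖iteratedDeriv i (fun θ : ℝ => (WithLp.toLp 2 (klFermiPoint μ K θ) : Momentum)) θ‖ ≤ D i)
    {Mk : ℕ → ℝ}
    (hMk : ∀ k, Mk k = (L : ℝ) ^ k * (6 * |β| * (L : ℝ) ^ 4 * ∑ σ : Fin 2, ∑ τ : Fin 2, 2 * (((Fintype.card (SpaceTimeIdx L M) : ℝ) ^ 4)⁻¹ *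
        ∑ x : Fin 4 → SpaceTimeIdx L M, ‖positionKernel L M β (klEffectiveAction L M β U μ K klE0 n) 4
          (fun i => ((x i, ![σ, σ, τ, τ] i), (![0, 1, 1, 0] : Fin 4 → Fin 2) i))‖)) *
          ∑ p₀ : MatsubaraIdx M, Da p₀ / (2 * Real.pi) ^ Mdeg * (2 / (L : ℝ)) ^ (Mdeg - 4) * (4 * ∑' k : Fin 2 → ℤ, ∏ j, (1 + (k j : ℝ) ^ 2)⁻¹))
    -- the one-line VALUE bound, uniformly in the angle
    {V₀ : ℝ} (hV₀ : ∀ θ : ℝ, |(tadpoleCont β μ K (klScale klE0 (n + 1)) (klScale klE0 n) (klEffectiveAction L M β U μ K klE0 n) (klFermiPoint μ K θ)).re| ≤ V₀)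
    {c c' : ℕ → ℝ}
    (hfit0 : V₀ +
        bell4 (twoPointMoment β
          (gaussConv ℂ (hubbardCovSliceCT L M β μ 0 K (klScale klE0 (n + 1)) (klScale klE0 n)) (klEffectiveAction L M β U μ K klE0 n) -
            klEffectiveAction L M β U μ K klE0 n -
            grassmannLaplacian ℂ (hubbardCovSliceCT L M β μ 0 K (klScale klE0 (n + 1)) (klScale klE0 n))
              (klEffectiveAction L M β U μ K klE0 n))) D 0 +
        bell4 (twoPointMoment β
          (effAction ℂ (hubbardCovSliceCT L M β μ 0 K (klScale klE0 (n + 1)) (klScale klE0 n)) (klEffectiveAction L M β U μ K klE0 n) -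
            gaussConv ℂ (hubbardCovSliceCT L M β μ 0 K (klScale klE0 (n + 1)) (klScale klE0 n)) (klEffectiveAction L M β U μ K klE0 n))) D 0 ≤
      curveJetBar c c' U 0 (n + 1))
    (hfit : ∀ k, 1 ≤ k → k ≤ 4 →
      ((2 * π) ^ 2)⁻¹ * (∑ p₀ : MatsubaraIdx M, (∑ i ∈ Finset.range (k + 1), (k.choose i : ℝ) * G i * Mv p₀ (k - i)) *
          ∫ ρ in Ioo (-r) r, ‖sliceSymbolFnXi (β * (L : ℝ) ^ 2) 0 (klScale klE0 (n + 1)) (klScale klE0 n) (matsubaraFreq β M p₀) ρ‖) +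
        bell4 Mk D k +
        bell4 (twoPointMoment β
          (gaussConv ℂ (hubbardCovSliceCT L M β μ 0 K (klScale klE0 (n + 1)) (klScale klE0 n)) (klEffectiveAction L M β U μ K klE0 n) -
            klEffectiveAction L M β U μ K klE0 n -
            grassmannLaplacian ℂ (hubbardCovSliceCT L M β μ 0 K (klScale klE0 (n + 1)) (klScale klE0 n))
              (klEffectiveAction L M β U μ K klE0 n))) D k +
        bell4 (twoPointMoment β
          (effAction ℂ (hubbardCovSliceCT L M β μ 0 K (klScale klE0 (n + 1)) (klScale klE0 n)) (klEffectiveAction L M β U μ K klE0 n) -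
            gaussConv ℂ (hubbardCovSliceCT L M β μ 0 K (klScale klE0 (n + 1)) (klScale klE0 n)) (klEffectiveAction L M β U μ K klE0 n))) D k ≤
      curveJetBar c c' U k (n + 1)) :
    TwoLegCurveJetBound L M c c' β U μ K (n + 1) := by
  have hlo' : a ≤ μ - A := by linarith
  have hhi' : μ + A ≤ b := by linarith
  obtain ⟨W, hW⟩ : ∃ W : HubbardGrassmann L M, W = klEffectiveAction L M β U μ K klE0 n := ⟨_, rfl⟩
  obtain ⟨R₁, hR₁⟩ : ∃ R₁ : HubbardGrassmann L M, R₁ =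
      gaussConv ℂ (hubbardCovSliceCT L M β μ 0 K (klScale klE0 (n + 1)) (klScale klE0 n)) (klEffectiveAction L M β U μ K klE0 n) -
        klEffectiveAction L M β U μ K klE0 n -
        grassmannLaplacian ℂ (hubbardCovSliceCT L M β μ 0 K (klScale klE0 (n + 1)) (klScale klE0 n)) (klEffectiveAction L M β U μ K klE0 n) :=
    ⟨_, rfl⟩
  obtain ⟨R₂, hR₂⟩ : ∃ R₂ : HubbardGrassmann L M, R₂ =
      effAction ℂ (hubbardCovSliceCT L M β μ 0 K (klScale klE0 (n + 1)) (klScale klE0 n)) (klEffectiveAction L M β U μ K klE0 n) -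
        gaussConv ℂ (hubbardCovSliceCT L M β μ 0 K (klScale klE0 (n + 1)) (klScale klE0 n)) (klEffectiveAction L M β U μ K klE0 n) := ⟨_, rfl⟩
  rw [← hW] at hVJ hMk hV₀
  rw [← hR₁, ← hR₂] at hfit hfit0
  set T : (Fin 2 → ℝ) → ℂ := fun P =>
    tadpoleCont β μ K (klScale klE0 (n + 1)) (klScale klE0 n) W P + localReadingCont β R₁ P + localReadingCont β R₂ P with hTdef
  have hT : T = fun P =>
      tadpoleCont β μ K (klScale klE0 (n + 1)) (klScale klE0 n) (klEffectiveAction L M β U μ K klE0 n) P +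
        localReadingCont β
          (gaussConv ℂ (hubbardCovSliceCT L M β μ 0 K (klScale klE0 (n + 1)) (klScale klE0 n)) (klEffectiveAction L M β U μ K klE0 n) -
            klEffectiveAction L M β U μ K klE0 n -
            grassmannLaplacian ℂ (hubbardCovSliceCT L M β μ 0 K (klScale klE0 (n + 1)) (klScale klE0 n))
              (klEffectiveAction L M β U μ K klE0 n)) P +
        localReadingCont β
          (effAction ℂ (hubbardCovSliceCT L M β μ 0 K (klScale klE0 (n + 1)) (klScale klE0 n)) (klEffectiveAction L M β U μ K klE0 n) -
            gaussConv ℂ (hubbardCovSliceCT L M β μ 0 K (klScale klE0 (n + 1)) (klScale klE0 n)) (klEffectiveAction L M β U μ K klE0 n)) P := by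
    rw [hTdef, hW, hR₁, hR₂]
  have h1 : ContDiff ℝ 4 fun θ : ℝ => (tadpoleCont β μ K (klScale klE0 (n + 1)) (klScale klE0 n) W (klFermiPoint μ K θ)).re :=
    IsCharPoly.contDiff_re_comp_klFermiPoint B hA hADt hlo' hhi' (isCharPoly_tadpoleCont β μ K _ _ W)
  have h2 : ContDiff ℝ 4 fun θ : ℝ => (localReadingCont β R₁ (klFermiPoint μ K θ)).re :=
    IsCharPoly.contDiff_re_comp_klFermiPoint B hA hADt hlo' hhi' (isCharPoly_localReadingCont β R₁)
  have h3 : ContDiff ℝ 4 fun θ : ℝ => (localReadingCont β R₂ (klFermiPoint μ K θ)).re :=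
    IsCharPoly.contDiff_re_comp_klFermiPoint B hA hADt hlo' hhi' (isCharPoly_localReadingCont β R₂)
  have hsplit : (fun θ' : ℝ => (T (klFermiPoint μ K θ')).re) = fun θ' : ℝ =>
      (tadpoleCont β μ K (klScale klE0 (n + 1)) (klScale klE0 n) W (klFermiPoint μ K θ')).re +
        (localReadingCont β R₁ (klFermiPoint μ K θ')).re + (localReadingCont β R₂ (klFermiPoint μ K θ')).re := by
    funext θ'
    rw [hTdef]
    simp only [Complex.add_re]
  refine twoLegCurveJetBound_succ_of_jets B hA hADt hlo' hhi' hβ U n hZ hT fun k hk θ => ?_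
  have hk' : (k : WithTop ℕ∞) ≤ 4 := by exact_mod_cast hk
  rw [hsplit, iteratedDeriv_fun_add ((h1.add h2).contDiffAt.of_le hk') (h3.contDiffAt.of_le hk'),
    iteratedDeriv_fun_add (h1.contDiffAt.of_le hk') (h2.contDiffAt.of_le hk')]
  refine (abs_add_le _ _).trans ((add_le_add ((abs_add_le _ _).trans (add_le_add le_rfl
    (abs_iteratedDeriv_re_localReadingCont_klFermiPoint_le β μ K R₁ hγ (hD θ) hk)))
    (abs_iteratedDeriv_re_localReadingCont_klFermiPoint_le β μ K R₂ hγ (hD θ) hk)).trans ?_)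
  rcases Nat.eq_zero_or_pos k with hk0 | hk1
  · subst hk0
    simp only [iteratedDeriv_zero]
    exact le_trans (by linarith [hV₀ θ]) hfit0
  · have htad := abs_iteratedDeriv_re_tadpoleCont_comp_le_theta B hA hADt hr hlo hhi hβ hΛ hΛΛ' hΛr W le_rfl hJjet hVJ hMv hM hDa hγ (hD θ) hMk hk
    exact le_trans (by linarith [htad]) (hfit k hk1 hk)

end Assembly

end Summit.HubbardSuperconductivity.HubbardSuperconductivity.Theorems.C4a

end
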